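import Summits.Schanuel.Schanuel.Theorems.RootDecomp1BRadicalDescent02

/-!
# RootDecomp1BRadicalDescent — lens 4, generations 30–31 «RADICAL DESCENT / STOREY-TWO CELLS» (RadicalDescent.lean g31 47a8f674…, 1887 l) — continuation (RootDecomp1BRadicalDescent03): §D prerequisites — `exists_int_relation`, `sX`, `Cf` and its size bounds, `Frel`, `exists_lipschitz_Frel`, `eigen_eq_Frel`, and the extracted clash inequality `clash_ineq` (private)

(lens-4 g30/g31 `RadicalDescent.lean`, sha256 47a8f674…751d, own farm rc 0 · 0 sorry · axioms std; critic VERDICT STATUS L1626 (d) PORT GO LOW, SOURCE UPDATE L1648;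
port by census-1 gen 15 in six parts `RootDecomp1BRadicalDescent01`–`06` — see the PORT NOTE of part 01; `--supports stmt-Schanuel-24622`; rung 0.)
-/

noncomputable section

open Complex

namespace Summit.Schanuel.Schanuel.Theorems.RootDecomp1BRadicalDescent

section PortCopies
open MvPolynomial
open Summit.Schanuel.Schanuel.Theorems.RootDecomp1KHyper (mvlen mvlen_nonneg mvlen_eq_sum_of_support_subset)
variable {n : ℕ}

/-- The length of a monomial `c · x^m` is at most `|c|`. -/
private theorem mvlen_monomial_le (m : Fin n →₀ ℕ) (c : ℤ) : mvlen (monomial m c) ≤ |c| := by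
  classical
  rw [mvlen_eq_sum_of_support_subset _ support_monomial_subset, Finset.sum_singleton, coeff_monomial,
    if_pos rfl]

/-- The length of the zero polynomial is `0`. -/
private theorem mvlen_zero : mvlen (0 : MvPolynomial (Fin n) ℤ) = 0 := by simp [mvlen]

/-- Subadditivity of the length. -/
private theorem mvlen_add_le (P Q : MvPolynomial (Fin n) ℤ) : mvlen (P + Q) ≤ mvlen P + mvlen Q := by
  classical
  rw [mvlen_eq_sum_of_support_subset _ support_add,
    mvlen_eq_sum_of_support_subset P (Finset.subset_union_left (s₂ := Q.support)),
    mvlen_eq_sum_of_support_subset Q (Finset.subset_union_right (s₁ := P.support)),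
    ← Finset.sum_add_distrib]
  exact Finset.sum_le_sum fun m _ => by rw [coeff_add]; exact abs_add_le _ _

/-- The length of a finite sum is at most the sum of the lengths. -/
private theorem mvlen_sum_le {ι : Type*} (s : Finset ι) (f : ι → MvPolynomial (Fin n) ℤ) :
    mvlen (∑ i ∈ s, f i) ≤ ∑ i ∈ s, mvlen (f i) := by
  classical
  induction s using Finset.induction_on with
  | empty => simp [mvlen_zero]
  | insert a s ha ih =>
    rw [Finset.sum_insert ha, Finset.sum_insert ha]
    exact (mvlen_add_le _ _).trans (by linarith)

/-- `mvlen (P · c x^a) ≤ mvlen P · |c|`. -/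
private theorem mvlen_mul_monomial_le (P : MvPolynomial (Fin n) ℤ) (a : Fin n →₀ ℕ) (b : ℤ) :
    mvlen (P * monomial a b) ≤ mvlen P * |b| := by
  classical
  have hP : P * monomial a b = ∑ m ∈ P.support, monomial (m + a) (P.coeff m * b) := by
    conv_lhs => rw [P.as_sum]
    rw [Finset.sum_mul]
    exact Finset.sum_congr rfl fun m _ => monomial_mul
  rw [hP]
  calc mvlen (∑ m ∈ P.support, monomial (m + a) (P.coeff m * b))
      ≤ ∑ m ∈ P.support, mvlen (monomial (m + a) (P.coeff m * b)) := mvlen_sum_le _ _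
    _ ≤ ∑ m ∈ P.support, |P.coeff m| * |b| :=
        Finset.sum_le_sum fun m _ => (mvlen_monomial_le _ _).trans_eq (abs_mul _ _)
    _ = mvlen P * |b| := by rw [← Finset.sum_mul]; rfl

/-- Multiplying by a power of a variable does not increase the length. -/
private theorem mvlen_mul_X_pow_le (P : MvPolynomial (Fin n) ℤ) (i : Fin n) (e : ℕ) :
    mvlen (P * X i ^ e) ≤ mvlen P := by
  rw [X_pow_eq_monomial]
  simpa using mvlen_mul_monomial_le P (Finsupp.single i e) 1

end PortCopies

/-! ## §D THE KERNEL THEOREM: radical (Kummer) descent -/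

section Kernel

open MvPolynomial
open Summit.Schanuel.Schanuel.Theorems.RootDecomp1KHyper (mvlen mvlen_nonneg abs_coeff_le_mvlen one_le_mvlen
  exists_int_mul_eq_map mvaeval_int_map exists_ball_eval_ne_zero)

variable {n : ℕ}

/-- An algebraically dependent tuple satisfies a nonzero INTEGER polynomial relation. -/
theorem exists_int_relation {N : ℕ} {v : Fin N → ℂ} (h : ¬ AlgebraicIndependent ℚ v) :
    ∃ P : MvPolynomial (Fin N) ℤ, P ≠ 0 ∧ MvPolynomial.aeval v P = 0 := by
  have h1 : ¬ Function.Injective (MvPolynomial.aeval v : MvPolynomial (Fin N) ℚ →ₐ[ℚ] ℂ) := h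
  rw [injective_iff_map_eq_zero] at h1
  push Not at h1
  obtain ⟨g, hg0, hgne⟩ := h1
  obtain ⟨M, G, hM, hG⟩ := exists_int_mul_eq_map g
  refine ⟨G, ?_, ?_⟩
  · intro hG0
    rw [hG0, map_zero] at hG
    have hC : (MvPolynomial.C (M : ℚ) : MvPolynomial (Fin N) ℚ) ≠ 0 :=
      MvPolynomial.C_eq_zero.not.mpr (by exact_mod_cast hM)
    exact (mul_ne_zero hC hgne) hG.symm
  · rw [← mvaeval_int_map _ G, hG, map_mul, MvPolynomial.aeval_C, hg0, mul_zero]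

/-- `x^k ≤ exp (k x)` for `x ≥ 0`. -/
private theorem pow_le_exp_mul {x : ℝ} (hx : 0 ≤ x) (k : ℕ) : x ^ k ≤ Real.exp (k * x) := by
  rw [Real.exp_nat_mul]
  exact pow_le_pow_left₀ hx (by linarith [Real.add_one_le_exp x]) k

/-- `q ≤ exp q` for a natural number `q`. -/
private theorem natCast_le_exp (q : ℕ) : (q : ℝ) ≤ Real.exp q := by linarith [Real.add_one_le_exp (q : ℝ)]

/-- The `X`-part (coordinates `2, …, n+1`) of an exponent vector on `Fin (n+2)` (coordinate `0` is the
radical's variable `U`, coordinate `1` the Liouville variable `Y`). -/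
def sX (s : Fin (n + 2) →₀ ℕ) : Fin n →₀ ℕ := Finsupp.tail (Finsupp.tail s)

/-- Coordinates of the `X`-part: `sX s j = s (j+2)`. -/
theorem sX_apply (s : Fin (n + 2) →₀ ℕ) (j : Fin n) : sX s j = s j.succ.succ := by
  simp [sX, Finsupp.tail_apply]

/-- An exponent vector on `Fin (n+2)` is determined by its coordinates `0`, `1` and its `X`-part. -/
theorem eq_of_parts {s s' : Fin (n + 2) →₀ ℕ} (h0 : s 0 = s' 0) (h1 : s 1 = s' 1)
    (hX : sX s = sX s') : s = s' := by
  ext i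
  refine Fin.cases ?_ (fun i' => Fin.cases ?_ (fun j => ?_) i') i
  · exact h0
  · simpa using h1
  · have := congrArg (fun f : Fin n →₀ ℕ => f j) hX
    simpa [sX_apply] using this

variable (P : MvPolynomial (Fin (n + 2)) ℤ) (p q J : ℕ)

/-- `C_k := q^J · [U^k] P(U, p/q, X) ∈ ℤ[X]` — the specialised `U^k`-coefficient. -/
def Cf (k : ℕ) : MvPolynomial (Fin n) ℤ :=
  ∑ s ∈ P.support with s 0 = k, monomial (sX s) (P.coeff s * (p : ℤ) ^ (s 1) * (q : ℤ) ^ (J - s 1))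

/-- The specialised coefficients `C_k` have total degree `≤ deg P`. -/
theorem totalDegree_Cf_le (k : ℕ) : (Cf P p q J k).totalDegree ≤ P.totalDegree := by
  unfold Cf
  refine totalDegree_finsetSum_le fun s hs => ?_
  refine (totalDegree_monomial_le _ _).trans ?_
  have hs' : s ∈ P.support := (Finset.mem_filter.1 hs).1
  refine le_trans ?_ (le_totalDegree hs')
  rw [Finsupp.sum_fintype _ _ (fun _ => rfl), Finsupp.sum_fintype _ _ (fun _ => rfl),
    Fin.sum_univ_succ, Fin.sum_univ_succ]
  simp only [sX_apply, id]
  omega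

/-- Length bound `mvlen C_k ≤ mvlen P · (p + q)^J` (when every `Y`-exponent of `P` is `≤ J`). -/
theorem mvlen_Cf_le (hJ : ∀ s ∈ P.support, s 1 ≤ J) (k : ℕ) :
    mvlen (Cf P p q J k) ≤ mvlen P * ((p : ℤ) + q) ^ J := by
  classical
  unfold Cf
  have hp0 : (0 : ℤ) ≤ p := Nat.cast_nonneg _
  have hq0 : (0 : ℤ) ≤ q := Nat.cast_nonneg _
  calc mvlen (∑ s ∈ P.support with s 0 = k,
        monomial (sX s) (P.coeff s * (p : ℤ) ^ (s 1) * (q : ℤ) ^ (J - s 1)))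
      ≤ ∑ s ∈ P.support with s 0 = k,
        mvlen (monomial (sX s) (P.coeff s * (p : ℤ) ^ (s 1) * (q : ℤ) ^ (J - s 1))) :=
        mvlen_sum_le _ _
    _ ≤ ∑ s ∈ P.support with s 0 = k, |P.coeff s| * ((p : ℤ) + q) ^ J :=
        Finset.sum_le_sum fun s hs => by
          refine (mvlen_monomial_le _ _).trans ?_
          rw [abs_mul, abs_mul, abs_pow, abs_pow, abs_of_nonneg hp0, abs_of_nonneg hq0, mul_assoc]
          refine mul_le_mul_of_nonneg_left ?_ (abs_nonneg _)
          have h1 := hJ s (Finset.mem_filter.1 hs).1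
          calc (p : ℤ) ^ (s 1) * (q : ℤ) ^ (J - s 1)
              ≤ ((p : ℤ) + q) ^ (s 1) * ((p : ℤ) + q) ^ (J - s 1) :=
                mul_le_mul (pow_le_pow_left₀ hp0 (by linarith) _)
                  (pow_le_pow_left₀ hq0 (by linarith) _) (by positivity) (by positivity)
            _ = ((p : ℤ) + q) ^ J := by rw [← pow_add, Nat.add_sub_cancel' h1]
    _ ≤ ∑ s ∈ P.support, |P.coeff s| * ((p : ℤ) + q) ^ J :=
        Finset.sum_le_sum_of_subset_of_nonneg (Finset.filter_subset _ _)
          (fun _ _ _ => by positivity)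
    _ = mvlen P * ((p : ℤ) + q) ^ J := by rw [← Finset.sum_mul]; rfl

/-- Entry length bound for the norm-form matrix: `mvlen (radMat C K p)_{l a} ≤ (K+1) · E₁` if every `mvlen C_k ≤ E₁`. -/
theorem mvlen_radMat_le {K : ℕ} (hq : 0 < q) (i₀ : Fin n) {E₁ : ℤ}
    (hE : ∀ k, mvlen (Cf P p q J k) ≤ E₁) (hE0 : 0 ≤ E₁) (l a : Fin q) :
    mvlen (radMat (Cf P p q J) K p hq i₀ l a) ≤ ((K : ℤ) + 1) * E₁ := by
  unfold radMat
  calc mvlen (∑ k ∈ (Finset.range (K + 1)).filter (fun k => resFin hq (p * k + l) = a),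
        Cf P p q J k * X i₀ ^ ((p * k + l) / q))
      ≤ ∑ k ∈ (Finset.range (K + 1)).filter (fun k => resFin hq (p * k + l) = a),
        mvlen (Cf P p q J k * X i₀ ^ ((p * k + l) / q)) := mvlen_sum_le _ _
    _ ≤ ∑ k ∈ (Finset.range (K + 1)).filter (fun k => resFin hq (p * k + l) = a), E₁ :=
        Finset.sum_le_sum fun k _ => (mvlen_mul_X_pow_le _ _ _).trans (hE k)
    _ ≤ ∑ _k ∈ Finset.range (K + 1), E₁ :=
        Finset.sum_le_sum_of_subset_of_nonneg (Finset.filter_subset _ _) (fun _ _ _ => hE0)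
    _ = ((K : ℤ) + 1) * E₁ := by simp

/-- Entry degree bound for the norm-form matrix: `deg (radMat C K p)_{l a} ≤ deg P + B·K` when `p ≤ B q`. -/
theorem totalDegree_radMat_le {K B : ℕ} (hq : 0 < q) (i₀ : Fin n) (hp : p ≤ B * q) (l a : Fin q) :
    (radMat (Cf P p q J) K p hq i₀ l a).totalDegree ≤ P.totalDegree + B * K := by
  unfold radMat
  refine totalDegree_finsetSum_le fun k hk => ?_
  have hkK : k ≤ K := Nat.lt_succ_iff.1 (Finset.mem_range.1 (Finset.mem_filter.1 hk).1)
  refine (totalDegree_mul _ _).trans (add_le_add (totalDegree_Cf_le P p q J k) ?_)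
  rw [totalDegree_X_pow]
  calc (p * k + l) / q ≤ (B * q * K + l) / q :=
        Nat.div_le_div_right (by nlinarith [Nat.mul_le_mul hp hkK])
    _ = B * K + l / q := by
        rw [show B * q * K + (l : ℕ) = q * (B * K) + l by ring, Nat.mul_add_div hq]
    _ = B * K := by rw [Nat.div_eq_of_lt l.isLt, add_zero]

/-- Evaluation of `C_k` at `θ`, expanded over the monomials of `P` with `U`-exponent `k`. -/
theorem aeval_Cf (θ : Fin n → ℂ) (k : ℕ) :
    aeval θ (Cf P p q J k) = ∑ s ∈ P.support with s 0 = k,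
      (((P.coeff s * (p : ℤ) ^ (s 1) * (q : ℤ) ^ (J - s 1) : ℤ)) : ℂ) * ∏ j, θ j ^ (s j.succ.succ) := by
  unfold Cf
  rw [map_sum]
  refine Finset.sum_congr rfl fun s _ => ?_
  rw [aeval_monomial, algebraMap_int_eq, eq_intCast, Finsupp.prod_fintype _ _ (fun _ => by simp)]
  simp only [sX_apply]

/-- `F(x) := P(e^{x y₀}, x, θ)`, expanded monomially: a `C¹` map `ℝ → ℂ`. -/
def Frel (θ : Fin n → ℂ) (y₀ : ℂ) (x : ℝ) : ℂ :=
  ∑ s ∈ P.support, ((P.coeff s : ℤ) : ℂ) *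
    (cexp ((x : ℂ) * y₀) ^ (s 0) * ((x : ℂ) ^ (s 1) * ∏ j, θ j ^ (s j.succ.succ)))

/-- `F(x) = P(e^{x y₀}, x, θ)` as an `MvPolynomial.aeval`. -/
theorem Frel_eq_aeval (θ : Fin n → ℂ) (y₀ : ℂ) (x : ℝ) :
    Frel P θ y₀ x =
      aeval (Fin.cons (cexp ((x : ℂ) * y₀)) (Fin.cons (x : ℂ) θ) : Fin (n + 2) → ℂ) P := by
  unfold Frel
  rw [MvPolynomial.aeval_def, MvPolynomial.eval₂_eq']
  refine Finset.sum_congr rfl fun s _ => ?_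
  rw [Fin.prod_univ_succ, Fin.prod_univ_succ]
  simp only [algebraMap_int_eq, eq_intCast, Fin.cons_zero, Fin.cons_succ]
  rfl

/-- `F` is `C¹` on `ℝ`. -/
theorem contDiff_Frel (θ : Fin n → ℂ) (y₀ : ℂ) : ContDiff ℝ 1 (Frel P θ y₀) := by
  have hx : ContDiff ℝ 1 (fun x : ℝ => (x : ℂ)) := Complex.ofRealCLM.contDiff
  show ContDiff ℝ 1 (fun x => Frel P θ y₀ x)
  unfold Frel
  refine ContDiff.sum fun s _ => ?_
  refine contDiff_const.mul (((Complex.contDiff_exp.comp (hx.mul contDiff_const)).pow _).mul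
    ((hx.pow _).mul contDiff_const))

/-- local Lipschitz bound of `Frel` at `ρ` -/
theorem exists_lipschitz_Frel (θ : Fin n → ℂ) (y₀ : ℂ) (ρ : ℝ) :
    ∃ Kl δ₁ : ℝ, 0 ≤ Kl ∧ 0 < δ₁ ∧
      ∀ x : ℝ, |x - ρ| < δ₁ → ‖Frel P θ y₀ x - Frel P θ y₀ ρ‖ ≤ Kl * |x - ρ| := by
  obtain ⟨K, t, ht, hK⟩ := ((contDiff_Frel P θ y₀).contDiffAt (x := ρ)).exists_lipschitzOnWith
  obtain ⟨δ₁, hδ₁, hball⟩ := Metric.mem_nhds_iff.mp ht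
  refine ⟨K, δ₁, K.2, hδ₁, fun x hx => ?_⟩
  have hxt : x ∈ t := hball (by rw [Metric.mem_ball, Real.dist_eq]; exact hx)
  have hρt : ρ ∈ t := hball (Metric.mem_ball_self hδ₁)
  have := (lipschitzOnWith_iff_dist_le_mul.mp hK) x hxt ρ hρt
  rwa [dist_eq_norm, Real.dist_eq] at this

/-- **The eigenvalue is `q^J F(p/q)`**: `Σ_k C_k(θ) w^{pk} = q^J · F(p/q)` when `w^p = e^{(p/q) y₀}`. -/
theorem eigen_eq_Frel (θ : Fin n → ℂ) (y₀ : ℂ) {K : ℕ} (hK : ∀ s ∈ P.support, s 0 ≤ K)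
    (hJ : ∀ s ∈ P.support, s 1 ≤ J) (hq : 0 < q) (w : ℂ)
    (hw : w ^ p = cexp (((((p : ℝ) / q : ℝ)) : ℂ) * y₀)) :
    ∑ k ∈ Finset.range (K + 1), aeval θ (Cf P p q J k) * w ^ (p * k) =
      (q : ℂ) ^ J * Frel P θ y₀ ((p : ℝ) / q) := by
  classical
  have hqC : (q : ℂ) ≠ 0 := by exact_mod_cast hq.ne'
  simp_rw [aeval_Cf, Finset.sum_mul]
  have step : ∀ k ∈ Finset.range (K + 1),
      ∑ s ∈ P.support with s 0 = k,
        (((P.coeff s * (p : ℤ) ^ (s 1) * (q : ℤ) ^ (J - s 1) : ℤ)) : ℂ) *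
          (∏ j, θ j ^ (s j.succ.succ)) * w ^ (p * k) =
      ∑ s ∈ P.support with s 0 = k,
        (q : ℂ) ^ J * (((P.coeff s : ℤ) : ℂ) *
          (cexp (((((p : ℝ) / q : ℝ)) : ℂ) * y₀) ^ (s 0) *
            (((((p : ℝ) / q : ℝ)) : ℂ) ^ (s 1) * ∏ j, θ j ^ (s j.succ.succ)))) := by
    intro k _
    refine Finset.sum_congr rfl fun s hs => ?_
    have hsk : s 0 = k := (Finset.mem_filter.1 hs).2
    have hs1 : s 1 ≤ J := hJ s (Finset.mem_filter.1 hs).1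
    rw [← hsk, pow_mul, hw]
    have hpq : (p : ℂ) ^ (s 1) * (q : ℂ) ^ (J - s 1) =
        (q : ℂ) ^ J * (((((p : ℝ) / q : ℝ)) : ℂ)) ^ (s 1) := by
      rw [← pow_sub_mul_pow (q : ℂ) hs1]
      push_cast
      rw [div_pow]
      field_simp
    simp only [Int.cast_mul, Int.cast_pow, Int.cast_natCast]
    linear_combination (((P.coeff s : ℤ) : ℂ) * (∏ j, θ j ^ (s j.succ.succ)) *
      cexp (((((p : ℝ) / q : ℝ)) : ℂ) * y₀) ^ (s 0)) * hpq
  rw [Finset.sum_congr rfl step,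
    Finset.sum_fiberwise_of_maps_to (fun s hs => Finset.mem_range.2 (Nat.lt_succ_of_le (hK s hs))),
    ← Finset.mul_sum]
  rfl

/-- PORT (census-1 gen 15): the final real-inequality step «(5) the clash» of the kernel proof, extracted
verbatim as a standalone lemma so that the kernel theorem fits the 400-line file cap (the kernel's last line calls it). `(Kl+1) e^{cU q²} e^{−e^{q^{A+1}}} < e^{−cN q² e^{a q^A}}`
once `q ≥ Q₁ > c₃ + 2 + a`, `c₃ = (Kl+1) + cU + cN`. -/
private theorem clash_ineq {Kl cU cN a c₃ : ℝ} {q A Q₁ : ℕ} (hKl : 0 ≤ Kl) (hcU0 : 0 ≤ cU)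
    (ha0 : 0 ≤ a) (hc₃ : c₃ = (Kl + 1) + cU + cN) (hc₃0 : 0 ≤ c₃) (hA1 : 1 ≤ A) (hq1r : (1 : ℝ) ≤ q)
    (hq0r : (0 : ℝ) < q) (hq2 : (1 : ℝ) ≤ (q : ℝ) ^ 2) (hQ₁ : c₃ + 2 + a < Q₁) (hqQ₁ : Q₁ ≤ q) :
    (Kl + 1) * Real.exp (cU * (q : ℝ) ^ 2) * Real.exp (-Real.exp ((q : ℝ) ^ (A + 1))) <
      Real.exp (-(cN * (q : ℝ) ^ 2 * Real.exp (a * (q : ℝ) ^ A))) := by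
  have h1 : Kl + 1 ≤ Real.exp (Kl + 1) := by linarith [Real.add_one_le_exp (Kl + 1)]
  have h2 : (Kl + 1) * Real.exp (cU * (q : ℝ) ^ 2) * Real.exp (-Real.exp ((q : ℝ) ^ (A + 1))) ≤
      Real.exp ((Kl + 1) + cU * (q : ℝ) ^ 2 - Real.exp ((q : ℝ) ^ (A + 1))) := by
    rw [sub_eq_add_neg, Real.exp_add, Real.exp_add]
    exact mul_le_mul_of_nonneg_right (mul_le_mul_of_nonneg_right h1 (Real.exp_pos _).le)
      (Real.exp_pos _).le
  refine h2.trans_lt ?_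
  rw [Real.exp_lt_exp]
  -- (Kl+1) + cU q² + cN q² exp(a q^A) < exp(q^(A+1))
  have hea : (1 : ℝ) ≤ Real.exp (a * (q : ℝ) ^ A) := Real.one_le_exp (by positivity)
  have h3 : (Kl + 1) + cU * (q : ℝ) ^ 2 + cN * (q : ℝ) ^ 2 * Real.exp (a * (q : ℝ) ^ A) ≤
      c₃ * ((q : ℝ) ^ 2 * Real.exp (a * (q : ℝ) ^ A)) := by
    rw [hc₃]
    have hX1 : (1 : ℝ) ≤ (q : ℝ) ^ 2 * Real.exp (a * (q : ℝ) ^ A) :=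
      one_le_mul_of_one_le_of_one_le hq2 hea
    have t1 : Kl + 1 ≤ (Kl + 1) * ((q : ℝ) ^ 2 * Real.exp (a * (q : ℝ) ^ A)) :=
      le_mul_of_one_le_right (by linarith) hX1
    have t2 : cU * (q : ℝ) ^ 2 ≤ cU * ((q : ℝ) ^ 2 * Real.exp (a * (q : ℝ) ^ A)) :=
      mul_le_mul_of_nonneg_left (le_mul_of_one_le_right (by positivity) hea) hcU0
    have t3 : cN * (q : ℝ) ^ 2 * Real.exp (a * (q : ℝ) ^ A) =
        cN * ((q : ℝ) ^ 2 * Real.exp (a * (q : ℝ) ^ A)) := by ring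
    have t4 : (Kl + 1 + cU + cN) * ((q : ℝ) ^ 2 * Real.exp (a * (q : ℝ) ^ A)) =
        (Kl + 1) * ((q : ℝ) ^ 2 * Real.exp (a * (q : ℝ) ^ A)) +
          cU * ((q : ℝ) ^ 2 * Real.exp (a * (q : ℝ) ^ A)) +
          cN * ((q : ℝ) ^ 2 * Real.exp (a * (q : ℝ) ^ A)) := by ring
    linarith only [t1, t2, t3, t4]
  have h4 : c₃ * ((q : ℝ) ^ 2 * Real.exp (a * (q : ℝ) ^ A)) ≤
      Real.exp (c₃ + 2 * q + a * (q : ℝ) ^ A) := by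
    have hc : c₃ ≤ Real.exp c₃ := by linarith [Real.add_one_le_exp c₃]
    have hqq : (q : ℝ) ^ 2 ≤ Real.exp (2 * q) := by
      have := natCast_le_exp q
      rw [show (2 : ℝ) * q = q + q by ring, Real.exp_add, sq]
      exact mul_le_mul this this hq0r.le (Real.exp_pos _).le
    calc c₃ * ((q : ℝ) ^ 2 * Real.exp (a * (q : ℝ) ^ A))
        ≤ Real.exp c₃ * (Real.exp (2 * q) * Real.exp (a * (q : ℝ) ^ A)) :=
          mul_le_mul hc (mul_le_mul_of_nonneg_right hqq (Real.exp_pos _).le) (by positivity)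
            (Real.exp_pos _).le
      _ = Real.exp (c₃ + 2 * q + a * (q : ℝ) ^ A) := by
          rw [← Real.exp_add, ← Real.exp_add]; congr 1; ring
  have h5 : c₃ + 2 * q + a * (q : ℝ) ^ A < (q : ℝ) ^ (A + 1) := by
    have hqA : (q : ℝ) ≤ (q : ℝ) ^ A := le_self_pow₀ hq1r (by omega)
    have hqA1 : (1 : ℝ) ≤ (q : ℝ) ^ A := one_le_pow₀ hq1r
    have hQ : c₃ + 2 + a < q := hQ₁.trans_le (by exact_mod_cast hqQ₁)
    have t1 : c₃ ≤ c₃ * (q : ℝ) ^ A := le_mul_of_one_le_right hc₃0 hqA1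
    have t2 : (c₃ + 2 + a) * (q : ℝ) ^ A = c₃ * (q : ℝ) ^ A + 2 * (q : ℝ) ^ A + a * (q : ℝ) ^ A := by
      ring
    calc c₃ + 2 * q + a * (q : ℝ) ^ A ≤ (c₃ + 2 + a) * (q : ℝ) ^ A := by linarith only [t1, t2, hqA]
      _ < (q : ℝ) * (q : ℝ) ^ A := mul_lt_mul_of_pos_right hQ (by positivity)
      _ = (q : ℝ) ^ (A + 1) := by ring
  linarith only [h3, h4, Real.exp_lt_exp.2 h5]

/-- PORT (census-1 gen 15, edition 2): the clash inequality EXPORTED for the kernel part `RootDecomp1BRadicalDescent04`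
(the private `clash_ineq` above is file-local; this public restatement is its only change). `(Kl+1) e^{cU q²} e^{−e^{q^{A+1}}}
< e^{−cN q² e^{a q^A}}` once `q ≥ Q₁ > c₃ + 2 + a`, `c₃ = (Kl+1) + cU + cN`. -/
theorem kernel_clash_ineq {Kl cU cN a c₃ : ℝ} {q A Q₁ : ℕ} (hKl : 0 ≤ Kl) (hcU0 : 0 ≤ cU)
    (ha0 : 0 ≤ a) (hc₃ : c₃ = (Kl + 1) + cU + cN) (hc₃0 : 0 ≤ c₃) (hA1 : 1 ≤ A) (hq1r : (1 : ℝ) ≤ q)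
    (hq0r : (0 : ℝ) < q) (hq2 : (1 : ℝ) ≤ (q : ℝ) ^ 2) (hQ₁ : c₃ + 2 + a < Q₁) (hqQ₁ : Q₁ ≤ q) :
    (Kl + 1) * Real.exp (cU * (q : ℝ) ^ 2) * Real.exp (-Real.exp ((q : ℝ) ^ (A + 1))) <
      Real.exp (-(cN * (q : ℝ) ^ 2 * Real.exp (a * (q : ℝ) ^ A))) :=
  clash_ineq hKl hcU0 ha0 hc₃ hc₃0 hA1 hq1r hq0r hq2 hQ₁ hqQ₁

end Kernel

end Summit.Schanuel.Schanuel.Theorems.RootDecomp1BRadicalDescent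

end
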